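import Literature.Computability.Complexity.HardcoreInapproximabilitySecondMomentFormula
import Literature.Computability.Complexity.HardcoreInapproximabilitySecondMomentEps
import HarnessLib

/-!
# Sly (2010), Lemma 3.1 / Theorem 3.10 — the first moment of `Z_{a,b}(η)`, counted exactly

For the configuration-type core `G̃` of [Sly2010, §2.1] realised by `q` big matchings
`σ_c ∈ Perm (Fin (n+m'))` and one small matching `τ ∈ Perm (Fin n)`, the slice count
`Z_{a,b}(η)(ω) = slyZab n m' q a b E⁺ E⁻ ω` (independent `(S,T)` with `|S| = a`, `|T| = b` and boundary
`η = (E⁺, E⁻)`) has total mass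
`Σ_ω Z_{a,b} = C(n,a) C(n,b) · K₁,big^q · K₁,small` (`sly_firstMoment_count`), and the one-rectangle
avoidance count is `K₁ = A! (N-A)! C(N-B, A)` (`pairAvoidSum_self_eq`), whence the normalised form
`Σ_ω Z_{a,b} / |Ω| = C(n,a) C(n,b) (C(N-B',A')/C(N,A'))^q C(n-b,a)/C(n,a)` (`sum_slyZab_div`).

## References
* [Sly2010] A. Sly, *Computational transition at the uniqueness threshold*, FOCS 2010,
  arXiv:1005.5584, proof of Lemma 3.1 and of Theorem 3.10.
-/

namespace Literature.Computability.Complexity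

open Real Finset Nat

section FirstMoment

variable {n m' q : ℕ}

open scoped Classical in
/-- **The first moment of `Z_{a,b}(η)`, counted**: every slice configuration `(S, T)` is compatible
with the same number `K₁,big^q · K₁,small` of core realisations. [cite: Sly2010, proof of Lemma 3.1] -/
theorem sly_firstMoment_count (n m' q a b : ℕ) (Ep Em : Finset (Fin m')) :
    ∑ ω : (Fin q → Equiv.Perm (Fin (n + m'))) × Equiv.Perm (Fin n), slyZab n m' q a b Ep Em ω =
      n.choose a * n.choose b *
        (pairAvoidSum (n + m') (pairSizes (n + m') (a + Ep.card) (a + Ep.card) (a + Ep.card))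
            (pairSizes (n + m') (b + Em.card) (b + Em.card) (b + Em.card)) ^ q *
          pairAvoidSum n (pairSizes n a a a) (pairSizes n b b b)) := by
  classical
  set PA := (univ : Finset (Fin n)).powersetCard a with hPA
  set PB := (univ : Finset (Fin n)).powersetCard b with hPB
  have hZ : ∀ ω : (Fin q → Equiv.Perm (Fin (n + m'))) × Equiv.Perm (Fin n),
      slyZab n m' q a b Ep Em ω =
        ∑ ST ∈ PA ×ˢ PB, if SlyCoreIndep ω.1 ω.2 ST.1 ST.2 Ep Em then 1 else 0 := by
    intro ω
    rw [slyZab, ← hPA, ← hPB, Finset.card_filter]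
  simp_rw [hZ]
  rw [Finset.sum_comm]
  have hcount : ∀ ST ∈ PA ×ˢ PB,
      (∑ ω : (Fin q → Equiv.Perm (Fin (n + m'))) × Equiv.Perm (Fin n),
        if SlyCoreIndep ω.1 ω.2 ST.1 ST.2 Ep Em then 1 else 0) =
      pairAvoidSum (n + m') (pairSizes (n + m') (a + Ep.card) (a + Ep.card) (a + Ep.card))
          (pairSizes (n + m') (b + Em.card) (b + Em.card) (b + Em.card)) ^ q *
        pairAvoidSum n (pairSizes n a a a) (pairSizes n b b b) := by
    intro ST hST
    rw [Finset.mem_product] at hST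
    have hS := (Finset.mem_powersetCard.1 hST.1).2
    have hT := (Finset.mem_powersetCard.1 hST.2).2
    have h := card_realisations_both (q := q) Ep Em hS hS hT hT
    rw [Finset.inter_self, Finset.inter_self, hS, hT, Fintype.card_subtype] at h
    rw [Finset.sum_boole, Nat.cast_id, ← h]
    congr 1
    refine Finset.filter_congr fun ω _ => ?_
    exact (and_self_iff).symm
  rw [Finset.sum_congr rfl hcount, Finset.sum_const, smul_eq_mul, Finset.card_product, hPA, hPB,
    Finset.card_powersetCard, Finset.card_powersetCard, Finset.card_univ, Fintype.card_fin]

end FirstMoment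

section ColourIdentity

/-- The one-rectangle count in the ε-form: `K₁ = A! (N-A)! C(N-B, A)`. [folklore] -/
theorem pairAvoidSum_self_eq {N A B : ℕ} (hA : A ≤ N) (hB : B ≤ N) :
    (pairAvoidSum N (pairSizes N A A A) (pairSizes N B B B) : ℝ) =
      (A ! : ℝ) * ((N - A) ! : ℝ) * ((N - B).choose A : ℝ) := by
  have h := pairAvoidSum_pairSizes_eq (N := N) (a := A) (b := B) (g := A) (h := B) le_rfl le_rfl
    (by omega) (by omega)
  have h' : (pairAvoidSum N (pairSizes N A A A) (pairSizes N B B B) : ℝ) =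
      ((A ! * (A - A) ! * (A - A) ! * (N - (A + A - A)) ! * (N - (B + B - B)).choose A : ℕ) : ℝ) *
        ∑ e ∈ range (A - A + 1),
          (((N - (B + B - B) - A).choose e * (B - B).choose (A - A - e) *
            (N - B - A - e).choose (A - A) : ℕ) : ℝ) := by
    exact_mod_cast h
  rw [h', Nat.sub_self, show A + A - A = A by omega, show B + B - B = B by omega, Nat.sub_self]
  simp

end ColourIdentity

section Normalised

variable {n m' q : ℕ}

/-- `K₁ / N! = C(N-B, A)/C(N, A)`. [folklore] -/
theorem pairAvoidSum_self_div {N A B : ℕ} (hA : A ≤ N) (hB : B ≤ N) :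
    (pairAvoidSum N (pairSizes N A A A) (pairSizes N B B B) : ℝ) / (N ! : ℝ) =
      ((N - B).choose A : ℝ) / (N.choose A : ℝ) := by
  rw [pairAvoidSum_self_eq hA hB]
  have hch : (N.choose A : ℝ) * (A ! : ℝ) * ((N - A) ! : ℝ) = (N ! : ℝ) := by
    exact_mod_cast Nat.choose_mul_factorial_mul_factorial hA
  have hpos : (0 : ℝ) < N.choose A := by exact_mod_cast Nat.choose_pos hA
  have hf : (0 : ℝ) < N ! := by exact_mod_cast Nat.factorial_pos N
  rw [div_eq_div_iff hf.ne' hpos.ne', ← hch]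
  ring

open scoped Classical in
/-- **The first moment of `Z_{a,b}(η)`, normalised**:
`Σ_ω Z_{a,b}(ω) = |Ω| · C(n,a) C(n,b) · (C(N-b',a')/C(N,a'))^q · C(n-b,a)/C(n,a)` with `N = n+m'`,
`a' = a+|E⁺|`, `b' = b+|E⁻|`, `|Ω| = (N!)^q n!`. [cite: Sly2010, proof of Lemma 3.1] -/
theorem sum_slyZab_eq (n m' q a b : ℕ) (Ep Em : Finset (Fin m')) (ha : a ≤ n) (hb : b ≤ n)
    (ha' : a + Ep.card ≤ n + m') (hb' : b + Em.card ≤ n + m') :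
    (∑ ω : (Fin q → Equiv.Perm (Fin (n + m'))) × Equiv.Perm (Fin n), ((slyZab n m' q a b Ep Em ω : ℕ) : ℝ)) =
      ((((n + m') ! : ℕ) : ℝ) ^ q * ((n ! : ℕ) : ℝ)) *
        ((n.choose a : ℝ) * (n.choose b : ℝ) *
          (((((n + m') - (b + Em.card)).choose (a + Ep.card) : ℝ) / ((n + m').choose (a + Ep.card) : ℝ)) ^ q *
            (((n - b).choose a : ℝ) / (n.choose a : ℝ)))) := by
  have h := sly_firstMoment_count n m' q a b Ep Em
  have hr : (∑ ω : (Fin q → Equiv.Perm (Fin (n + m'))) × Equiv.Perm (Fin n), ((slyZab n m' q a b Ep Em ω : ℕ) : ℝ)) =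
      (n.choose a : ℝ) * (n.choose b : ℝ) *
        ((pairAvoidSum (n + m') (pairSizes (n + m') (a + Ep.card) (a + Ep.card) (a + Ep.card))
            (pairSizes (n + m') (b + Em.card) (b + Em.card) (b + Em.card)) : ℝ) ^ q *
          (pairAvoidSum n (pairSizes n a a a) (pairSizes n b b b) : ℝ)) := by
    exact_mod_cast congrArg (Nat.cast : ℕ → ℝ) h
  rw [hr, ← pairAvoidSum_self_div ha' hb', ← pairAvoidSum_self_div ha hb]
  have hf1 : (0 : ℝ) < (n + m') ! := by exact_mod_cast Nat.factorial_pos _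
  have hf2 : (0 : ℝ) < n ! := by exact_mod_cast Nat.factorial_pos _
  rw [div_pow]
  field_simp

end Normalised

end Literature.Computability.Complexity
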